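import Summits.KontsevichZagierPeriods.Zeta5Search.CasoratianLawGoodClasses
import Summits.KontsevichZagierPeriods.Zeta5Search.CasoratianClassBoundProof
import Summits.KontsevichZagierPeriods.Zeta5Search.LemmaDBonusProof
import Summits.KontsevichZagierPeriods.Zeta5Search.PalindromicVCarrierBonusProof
import Summits.KontsevichZagierPeriods.Zeta5Search.RVLargeParamVCover
import HarnessLib

/-!
# RVClassLawCover — the proved class-law tools of the tree as ONE decidable cover guard (fam-rv gen 12, file 1; request #12.1)

HONEST FRAMING: systematic search; no irrationality claim unless certified.  Cell `pub-zeta5`, family `rv`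
(Rhin–Viola / flat-gauge programme), generation 12.  This file contains NO conjecture node.  It packages, POINTWISE in
`(b, j, p)`, every tree theorem that bounds `v_p(Cas_j(b))` from below at a window prime into one Boolean certificate
`coverGuard b j p δ` (digit-free: it reads only the block configuration of `b` and `b + e_j`) together with its soundness
theorem

* `classLaw_of_coverGuard : … → coverGuard b j p δ = true → Cas_j(b) ≠ 0 → refund − N_p + δ ≤ v_p(Cas_j(b))`,

a class law WITH BONUS `δ` (gen 8's (CV⁺) shape).  The six disjuncts and the tree theorems they invoke:

* (E)  `H(3)` and `δ ≤ 0` — `ClusterValuation.casoratianLaw_of_goodClasses` (typer g9);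
* (LB) `refund − N_p + δ ≤ casLB b p` — THEOREM LB `ClusterValuation.casoratianClassBound_holds` (typer g8);
* (Z)  `H(3)` and both constant terms pass one of gen 9's four (V⁺) tests at exponent `−N_p + δ` (`provedCaseZ`) — the NEW
       pointwise lemma `ClusterValuation.casoratianLaw_of_goodClasses_vBonus` below (= `casoratianLaw_of_goodClasses` with
       gen 9's `V`-bonus bookkeeping of `RVLargeParamVFloor.casoratianLaw_of_vBonus`; under `H(3)` every class piece `𝒦_x` of
       `b` and of `b + e_j` is divisible by `p`, so a floor `v_p V ≥ −N_p + δ` for both constant terms lifts the bracket to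
       `1 − N_p + δ`);
* (J)  `refund − N_p + δ ≤ casLB + 1`, `p ≤ b₀`, `p ≤ d`, and the four class hypotheses of `LemmaDBonus` with
       `m = −multiDepth b p` — `lemmaDBonus_holds` (typer);
* (Y)  same window, the hypotheses of `PalindromicVCarrierBonus` with `M = multiDepth`, `N = singleDepth` —
       `palindromicVCarrierBonus_holds`;
* (B)  `refund − N_p + δ ≤ casLB + 2`, same window, the hypotheses of `DoubleDropBonus` with `N = multiDepth` —
       `doubleDropBonus_holds`.

(The collinearity rungs O/X of census g18, `casLB_succ_le_of_ccGuard` / `casLB_succ_le_of_ccGuardT`, are NOT part of the Boolean: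
their guard `ccGuard` reads `levelVec` through `Finset.sort` and does not reduce in the kernel, so a `decide` of it is impossible;
on zone C they would add only 18 (`p = 5`) + 239 (`p = 7`) instances, all with `zcGamma ≥ 1`, to the cover below.)

USE (file 2 of this generation, `RVFlatGaugeZoneCResidual.lean`): with `δ := ZoneC.zcBonus b p i₁ i₂` the guard decides, instance
by instance, gen 11's two-long-block node `RVFlatGauge.TwoLongClassLaw`; the exact census of that file's docstring
(`pub-zeta5-fam-rv/gen12/cover5.py`, rows `gen11/out/*.rows.json`, `gen12/out/zoneC2_p7_15_20.rows.json`; zone C is FINITE at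
each prime, `b₀ < 3p`, and the census is COMPLETE at `p = 5` and `p = 7`; script `cover6.py`): the guard fires on 1,856 of the 2,704 zone-C instances
`(b, j)` at `p = 5` (68.6 %) and on 15,756 of 22,098 at `p = 7` (71.3 %), including EVERY instance with `zcGamma ≤ 0` (805 and
7,281) — so on zone C the bonus-free class law (CV) is, at `p ∈ {5, 7}`, instance-wise a consequence of tree theorems, and what is
left of `TwoLongClassLaw` there is the FLAT-side bonus `zcGamma ≥ 1` (848 + 6,342 instances, 25 + 51 configuration types; the node
is attained with equality in 803 + 6,070 of them).
`p`-adic valuations of rational numbers only; nothing about irrationality.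
-/

noncomputable section

open Finset

namespace Summit.KontsevichZagierPeriods.Zeta5Search.ClusterValuation

open Summit.KontsevichZagierPeriods.Zeta5Search.WedgeDictionary (coeffV dOf)
open Summit.KontsevichZagierPeriods.Zeta5Search.CasoratianValuation (InPolytope pairFloors refund shift casoratian)
open Summit.KontsevichZagierPeriods.Zeta5Search.PadicSeries

variable {p : ℕ} [hp : Fact p.Prime]

/-! ### (CV) under `H(3)` with a `V`-bonus (disjunct (Z)) -/

/-- **The `𝒦`-bracket under `H(3)` with a `V`-bonus**: if every multipole class has `3 + E_x ≥ 1` and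
`‖V(b)‖_p, ‖V(b+e_j)‖_p ≤ p^{N_p(b) − δ}`, then `v_p(𝒦_p(b⁺)V(b) − 𝒦_p(b)V(b⁺)) ≥ 1 − N_p(b) + δ`
(every class piece `𝒦_x` of `b` and of `b + e_j` has `‖𝒦_x‖_p ≤ p⁻¹`, `padicNorm_classK_le_of_goodClasses`). -/
theorem kBracket_bound_of_goodClasses_vBonus (b : ℕ → ℤ) {j : ℕ} (hb : InPolytope b) (hj1 : 1 ≤ j)
    (hb' : InPolytope (shift b j)) (hp5 : 5 ≤ p) (hwin : (b 0 + 2 : ℤ) < (p : ℤ) ^ 2) (hgood : GoodClasses b p 3)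
    {δ : ℤ} (hVb : padicNorm p (coeffV b) ≤ (p : ℚ) ^ (pairFloors b p - δ))
    (hVb' : padicNorm p (coeffV (shift b j)) ≤ (p : ℚ) ^ (pairFloors b p - δ))
    (hne : kRes (shift b j) p * coeffV b - kRes b p * coeffV (shift b j) ≠ 0) :
    1 - pairFloors b p + δ ≤ padicValRat p (kRes (shift b j) p * coeffV b - kRes b p * coeffV (shift b j)) := by
  have hp0 : 0 < p := hp.out.pos
  have hpq : (p : ℚ) ≠ 0 := Nat.cast_ne_zero.2 hp.out.ne_zero
  have hsplit : kRes (shift b j) p * coeffV b - kRes b p * coeffV (shift b j) =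
      ∑ x ∈ range p, (classK (shift b j) p x * coeffV b - classK b p x * coeffV (shift b j)) := by
    rw [kRes_eq_sum_classK (shift b j) hp0, kRes_eq_sum_classK b hp0, sum_mul, sum_mul, ← sum_sub_distrib]
  have hexp : (-(1 - pairFloors b p + δ) : ℤ) = -1 + (pairFloors b p - δ) := by ring
  apply val_ge_of_padicNorm_le hne
  rw [hsplit]
  refine padicNorm.sum_le' (fun x hx => ?_) (zpow_p_nonneg _)
  obtain ⟨hK, hK'⟩ := padicNorm_classK_le_of_goodClasses b hb hj1 hb' hp5 hwin hgood (mem_range.1 hx)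
  rw [hexp, zpow_add₀ hpq]
  refine (padicNorm.sub (p := p)).trans (max_le ?_ ?_)
  · rw [padicNorm.mul]
    exact mul_le_mul hK' hVb (padicNorm.nonneg _) (zpow_p_nonneg _)
  · rw [padicNorm.mul]
    exact mul_le_mul hK hVb' (padicNorm.nonneg _) (zpow_p_nonneg _)

/-- **(CV) under `H(3)` with a constant-term bonus** (pointwise): if every multipole class of `b` modulo `p` has
`3 + E_x ≥ 1` and both constant terms satisfy `v_p V(b), v_p V(b+e_j) ≥ −N_p(b) + δ`, then
`v_p Cas_j(b) ≥ min(1,⌊d/p⌋) − N_p(b) + δ`. -/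
theorem casoratianLaw_of_goodClasses_vBonus (b : ℕ → ℤ) {j : ℕ} (hb : InPolytope b) (hj1 : 1 ≤ j) (hj7 : j ≤ 7)
    (hb' : InPolytope (shift b j)) (hp5 : 5 ≤ p) (hwin : (b 0 + 2 : ℤ) < (p : ℤ) ^ 2) (hgood : GoodClasses b p 3)
    (δ : ℤ) (hV : coeffV b ≠ 0 → -pairFloors b p + δ ≤ padicValRat p (coeffV b))
    (hV' : coeffV (shift b j) ≠ 0 → -pairFloors b p + δ ≤ padicValRat p (coeffV (shift b j)))
    (hcas : casoratian b j ≠ 0) :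
    refund b p - pairFloors b p + δ ≤ padicValRat p (casoratian b j) := by
  have hpp := hp.out
  have hp1 : (1 : ℚ) < p := by exact_mod_cast hpp.one_lt
  have hd0 : 0 ≤ dOf b := by
    have := hb.2.2; unfold dOf; linarith
  have hdshift : dOf (shift b j) = dOf b - 1 := BigPrime.dOf_shift b hj1 hj7
  have hexp : (-(-pairFloors b p + δ) : ℤ) = pairFloors b p - δ := by ring
  have hVb : padicNorm p (coeffV b) ≤ (p : ℚ) ^ (pairFloors b p - δ) := by
    have h := padicNorm_le_of_val (p := p) hV; rwa [hexp] at h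
  have hVb' : padicNorm p (coeffV (shift b j)) ≤ (p : ℚ) ^ (pairFloors b p - δ) := by
    have h := padicNorm_le_of_val (p := p) hV'; rwa [hexp] at h
  have hBb : padicNorm p (kRes (shift b j) p * coeffV b - kRes b p * coeffV (shift b j))
      ≤ (p : ℚ) ^ (-(1 - pairFloors b p + δ)) :=
    padicNorm_le_of_val (fun h => kBracket_bound_of_goodClasses_vBonus b hb hj1 hb' hp5 hwin hgood hVb hVb' h)
  have hΩint : ∀ b' : ℕ → ℤ, InPolytope b' → padicNorm p (omegaRes b' p) ≤ 1 := fun b' hb'' =>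
    padicNorm_omegaRes_le_one b' hb'' (by omega)
  apply val_ge_of_padicNorm_le hcas
  rw [casoratian_split b j p]
  by_cases hpd : (p : ℤ) ≤ dOf b
  · rw [omegaRes_eq_zero b hb (by omega), omegaRes_eq_zero (shift b j) hb' (by rw [hdshift]; omega), zero_mul, zero_mul,
      sub_zero, zero_sub, padicNorm.neg]
    refine hBb.trans (zpow_le_zpow_right₀ hp1.le ?_)
    have : refund b p ≤ 1 := min_le_left _ _
    linarith
  · have hr : refund b p = 0 := by
      unfold refund
      rw [Int.ediv_eq_zero_of_lt hd0 (by omega)]; simp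
    have hexp' : (-(refund b p - pairFloors b p + δ) : ℤ) = pairFloors b p - δ := by rw [hr]; ring
    rw [hexp']
    refine (padicNorm.sub (p := p)).trans (max_le ((padicNorm.sub (p := p)).trans (max_le ?_ ?_)) ?_)
    · rw [padicNorm.mul]
      calc padicNorm p (omegaRes (shift b j) p) * padicNorm p (coeffV b) ≤ 1 * (p : ℚ) ^ (pairFloors b p - δ) :=
            mul_le_mul (hΩint _ hb') hVb (padicNorm.nonneg _) zero_le_one
        _ = _ := one_mul _
    · rw [padicNorm.mul]
      calc padicNorm p (omegaRes b p) * padicNorm p (coeffV (shift b j)) ≤ 1 * (p : ℚ) ^ (pairFloors b p - δ) :=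
            mul_le_mul (hΩint _ hb) hVb' (padicNorm.nonneg _) zero_le_one
        _ = _ := one_mul _
    · exact hBb.trans (zpow_le_zpow_right₀ hp1.le (by linarith))

/-! ### The depths at which the bonus rungs are instantiated, and their decidable guards -/

/-- Minus the least class exponent `E_x` over the MULTIPOLE classes of `b` modulo `p` (`0` if there is none): the `N` of
`DoubleDropBonus` (and of census g18's `ccGuard`), the `M` of `PalindromicVCarrierBonus`, minus the `m` of `LemmaDBonus`. -/
def multiDepth (b : ℕ → ℤ) (p : ℕ) : ℕ := (multipoleClasses b p).sup fun x => (-classExp b p x).toNat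

/-- Minus the least `ν_y` over the SINGLE-POLE classes (`0` if there is none): the `N` of `PalindromicVCarrierBonus`. -/
def singleDepth (b : ℕ → ℤ) (p : ℕ) : ℕ :=
  ((range p).filter fun y => classPoleCount b p y = 1).sup fun y => (-classNu b p y).toNat

/-- Rung J: the four class hypotheses of `LemmaDBonus` at `m = −multiDepth b p`, as one Boolean. -/
def rungJGuard (b : ℕ → ℤ) (p : ℕ) : Bool :=
  decide ((∃ x ∈ multipoleClasses b p, classExp b p x = -(multiDepth b p : ℤ)) ∧
    (∀ x ∈ multipoleClasses b p, -(multiDepth b p : ℤ) ≤ classExp b p x) ∧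
    (∀ y ∈ range p, classPoleCount b p y = 1 → -(multiDepth b p : ℤ) ≤ -3 ∧ -(multiDepth b p : ℤ) < classNu b p y) ∧
    (∀ x ∈ multipoleClasses b p, ∀ y ∈ multipoleClasses b p,
      classExp b p x = -(multiDepth b p : ℤ) → classExp b p y = -(multiDepth b p : ℤ) →
        droppedPair b p x = false → droppedPair b p y = false → sameType b p x y = true))

/-- Rung Y: the hypotheses of `PalindromicVCarrierBonus` at `M = multiDepth b p`, `N = singleDepth b p`, as one Boolean. -/
def rungYGuard (b : ℕ → ℤ) (p : ℕ) : Bool :=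
  decide (3 ≤ multiDepth b p ∧ multiDepth b p < singleDepth b p ∧ Even (singleDepth b p) ∧
    (∃ x ∈ multipoleClasses b p, classExp b p x = -(multiDepth b p : ℤ)) ∧
    (∀ x ∈ multipoleClasses b p, -(multiDepth b p : ℤ) ≤ classExp b p x) ∧
    (∃ y ∈ range p, classPoleCount b p y = 1 ∧ classNu b p y = -(singleDepth b p : ℤ)) ∧
    (∀ y ∈ range p, classPoleCount b p y = 1 → -(singleDepth b p : ℤ) ≤ classNu b p y) ∧
    (∀ y ∈ range p, classPoleCount b p y = 1 → classNu b p y = -(singleDepth b p : ℤ) →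
      ¬ CentreIn b p y ∧
        (∀ s ∈ classSet b p y, netExp b s = netExp b ((b 0).toNat - ((b 0).toNat - y) % p - (s - y)))))

/-- Rung B: the hypotheses of `DoubleDropBonus` at `N = multiDepth b p`, as one Boolean. -/
def rungBGuard (b : ℕ → ℤ) (p : ℕ) : Bool :=
  decide (3 ≤ multiDepth b p ∧ Even (multiDepth b p) ∧
    (∀ x ∈ range p, classExp b p x < -(multiDepth b p : ℤ) → classPoleCount b p x = 1 ∧ tameSingle b p x = true) ∧
    (∃ x ∈ multipoleClasses b p, classExp b p x = -(multiDepth b p : ℤ)) ∧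
    (∀ x ∈ deepClasses b p (multiDepth b p), (classPoleCount b p x = 1 ∧ tameSingle b p x = true) ∨
      (¬ CentreIn b p x ∧
        (∀ s ∈ classSet b p x, netExp b s = netExp b ((b 0).toNat - ((b 0).toNat - x) % p - (s - x))))))

/-- **Rung J, pointwise**: `rungJGuard` certifies the hypotheses of `lemmaDBonus_holds`. -/
theorem casLB_succ_le_of_rungJGuard (b : ℕ → ℤ) {j : ℕ} (hb : InPolytope b) (hj1 : 1 ≤ j) (hj7 : j ≤ 7)
    (hb' : InPolytope (shift b j)) (hp5 : 5 ≤ p) (hpb : (p : ℤ) ≤ b 0) (hpd : (p : ℤ) ≤ dOf b)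
    (hwin : (b 0 + 2 : ℤ) < (p : ℤ) ^ 2) (H : rungJGuard b p = true) (hcas : casoratian b j ≠ 0) :
    casLB b p + 1 ≤ padicValRat p (casoratian b j) := by
  simp only [rungJGuard, decide_eq_true_eq] at H
  obtain ⟨h1, h2, h3, h4⟩ := H
  exact lemmaDBonus_holds b j p _ hb hj1 hj7 hb' hp.out hp5 hpb hpd hwin h1 h2
    (fun y hy hc => h3 y (mem_range.2 hy) hc) h4 hcas

/-- **Rung Y, pointwise**: `rungYGuard` certifies the hypotheses of `palindromicVCarrierBonus_holds`. -/
theorem casLB_succ_le_of_rungYGuard (b : ℕ → ℤ) {j : ℕ} (hb : InPolytope b) (hj1 : 1 ≤ j) (hj7 : j ≤ 7)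
    (hb' : InPolytope (shift b j)) (hp5 : 5 ≤ p) (hpb : (p : ℤ) ≤ b 0) (hpd : (p : ℤ) ≤ dOf b)
    (hwin : (b 0 + 2 : ℤ) < (p : ℤ) ^ 2) (H : rungYGuard b p = true) (hcas : casoratian b j ≠ 0) :
    casLB b p + 1 ≤ padicValRat p (casoratian b j) := by
  simp only [rungYGuard, decide_eq_true_eq] at H
  obtain ⟨h3M, hMN, hev, hx1, hx2, hy1, hy2, hy3⟩ := H
  obtain ⟨y, hy, hc, hν⟩ := hy1
  exact palindromicVCarrierBonus_holds b p j _ _ hb hb' hj1 hj7 hp.out hp5 hpb hpd hwin h3M hMN hev hx1 hx2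
    ⟨y, mem_range.1 hy, hc, hν⟩ (fun y hy hc => hy2 y (mem_range.2 hy) hc) (fun y hy hc hν => hy3 y (mem_range.2 hy) hc hν) hcas

/-- **Rung B, pointwise**: `rungBGuard` certifies the hypotheses of `doubleDropBonus_holds`. -/
theorem casLB_add_two_le_of_rungBGuard (b : ℕ → ℤ) {j : ℕ} (hb : InPolytope b) (hj1 : 1 ≤ j) (hj7 : j ≤ 7)
    (hb' : InPolytope (shift b j)) (hp5 : 5 ≤ p) (hpb : (p : ℤ) ≤ b 0) (hpd : (p : ℤ) ≤ dOf b)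
    (hwin : (b 0 + 2 : ℤ) < (p : ℤ) ^ 2) (H : rungBGuard b p = true) (hcas : casoratian b j ≠ 0) :
    casLB b p + 2 ≤ padicValRat p (casoratian b j) := by
  simp only [rungBGuard, decide_eq_true_eq] at H
  obtain ⟨h3N, hev, hdeep, hx, hdc⟩ := H
  exact doubleDropBonus_holds b p j _ hb hb' hj1 hj7 hp.out hp5 hpb hpd hwin h3N hev
    (fun x hx' hE => hdeep x (mem_range.2 hx') hE) hx hdc hcas

end Summit.KontsevichZagierPeriods.Zeta5Search.ClusterValuation

namespace Summit.KontsevichZagierPeriods.Zeta5Search.RVFlatGauge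

open Summit.KontsevichZagierPeriods.Zeta5Search.CasoratianValuation (casoratian shift InPolytope pairFloors refund)
open Summit.KontsevichZagierPeriods.Zeta5Search.WedgeDictionary (coeffV dOf)
open Summit.KontsevichZagierPeriods.Zeta5Search.ClusterValuation

variable {p : ℕ}

/-! ### The cover guard and its soundness -/

/-- **THE COVER GUARD at bonus level `δ`** — one Boolean certificate, evaluable by `decide` on concrete data, for
"some tree theorem gives `v_p Cas_j(b) ≥ refund − N_p + δ`": disjuncts (E), (LB), (Z), (J), (Y), (B) of the module
docstring. -/
def coverGuard (b : ℕ → ℤ) (j p : ℕ) (δ : ℤ) : Bool :=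
  (decide (GoodClasses b p 3) && decide (δ ≤ 0)) ||
  decide (refund b p - pairFloors b p + δ ≤ casLB b p) ||
  (decide (GoodClasses b p 3) &&
    (provedCaseZ b p (-pairFloors b p + δ) && provedCaseZ (shift b j) p (-pairFloors b p + δ))) ||
  (decide ((p : ℤ) ≤ b 0) && decide ((p : ℤ) ≤ dOf b) &&
    ((decide (refund b p - pairFloors b p + δ ≤ casLB b p + 1) && (rungJGuard b p || rungYGuard b p)) ||
      (decide (refund b p - pairFloors b p + δ ≤ casLB b p + 2) && rungBGuard b p)))

/-- **THE CLASS LAW WITH BONUS, INSTANCE-WISE (no conjecture node)**: at a window prime, if the cover guard fires at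
level `δ` then `v_p Cas_j(b) ≥ min(1,⌊d/p⌋) − N_p(b) + δ`. -/
theorem classLaw_of_coverGuard (b : ℕ → ℤ) {j p : ℕ} (hb : InPolytope b) (hj1 : 1 ≤ j) (hj7 : j ≤ 7)
    (hb' : InPolytope (shift b j)) (hpr : p.Prime) (hp5 : 5 ≤ p) (hwin : (b 0 + 2 : ℤ) < (p : ℤ) ^ 2) {δ : ℤ}
    (hg : coverGuard b j p δ = true) (hcas : casoratian b j ≠ 0) :
    refund b p - pairFloors b p + δ ≤ padicValRat p (casoratian b j) := by
  haveI : Fact p.Prime := ⟨hpr⟩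
  have hwin' : (shift b j 0 + 2 : ℤ) < (p : ℤ) ^ 2 := by rwa [BigPrime.shift_zero b hj1]
  simp only [coverGuard, Bool.or_eq_true, Bool.and_eq_true, decide_eq_true_eq] at hg
  rcases hg with ((⟨hgood, hδ⟩ | hlb) | ⟨hgood, h1, h2⟩) | ⟨⟨hpb, hpd⟩, hrung⟩
  · have h := casoratianLaw_of_goodClasses b hb hj1 hj7 hb' hp5 hwin hgood hcas
    linarith
  · exact hlb.trans (casoratianClassBound_holds b j p hb hj1 hj7 hb' hpr hp5 hwin hcas)
  · exact casoratianLaw_of_goodClasses_vBonus b hb hj1 hj7 hb' hp5 hwin hgood δ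
      (fun hV => val_ge_of_provedCaseZ b hb hp5 hwin h1 hV)
      (fun hV => val_ge_of_provedCaseZ (shift b j) hb' hp5 hwin' h2 hV) hcas
  · rcases hrung with ⟨hle, hJ | hY⟩ | ⟨hle, hB⟩
    · exact hle.trans (casLB_succ_le_of_rungJGuard b hb hj1 hj7 hb' hp5 hpb hpd hwin hJ hcas)
    · exact hle.trans (casLB_succ_le_of_rungYGuard b hb hj1 hj7 hb' hp5 hpb hpd hwin hY hcas)
    · exact hle.trans (casLB_add_two_le_of_rungBGuard b hb hj1 hj7 hb' hp5 hpb hpd hwin hB hcas)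

/-- **(CV) instance-wise**: the bonus-free case `δ = 0`. -/
theorem casoratianLaw_of_coverGuard (b : ℕ → ℤ) {j p : ℕ} (hb : InPolytope b) (hj1 : 1 ≤ j) (hj7 : j ≤ 7)
    (hb' : InPolytope (shift b j)) (hpr : p.Prime) (hp5 : 5 ≤ p) (hwin : (b 0 + 2 : ℤ) < (p : ℤ) ^ 2)
    (hg : coverGuard b j p 0 = true) (hcas : casoratian b j ≠ 0) :
    refund b p - pairFloors b p ≤ padicValRat p (casoratian b j) := by
  have h := classLaw_of_coverGuard b hb hj1 hj7 hb' hpr hp5 hwin hg hcas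
  simpa using h

/-! ### Kernel instances (zone C of gen 11: two long blocks, `b₀ < 3p`) -/

/-- Disjunct (Z) with a genuine bonus: `b = (11; 5,5,5,5,4,3,0)`, `j = 5`, `p = 5` — `H(3)` holds, `N_5 = 6`, `refund = 1`,
`casLB = −5` is one short of the node value `refund − N_5 + 1 = −4` (gen 11's `zcGamma = 1`), and both constant terms pass a
(V⁺) test at exponent `−5 = −N_5 + 1`; the guard fires at `δ = 1` (exact value `v_5 Cas_5(b) = −4`). -/
example :
    let b : ℕ → ℤ := fun k => (([11, 5, 5, 5, 5, 4, 3, 0] : List ℤ)).getD k 0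
    pairFloors b 5 = 6 ∧ refund b 5 = 1 ∧ casLB b 5 = -5 ∧ GoodClasses b 5 3 ∧
      provedCaseZ b 5 (-5) = true ∧ provedCaseZ (shift b 5) 5 (-5) = true ∧ coverGuard b 5 5 1 = true := by
  decide

/-- Disjunct (J): the smallest two-long-block vector outside (E), (LB), (Z): `b = (6; 1,1,1,1,1,0,0)`, `j = 1`, `p = 5` —
`¬H(3)`, `N_5 = 11`, `casLB = −11`, `multiDepth = 7`, and the Lemma-D guard fires, giving `casLB + 1 = −10 = refund − N_5`
(exact value `v_5 Cas_1(b) = −10`). -/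
example :
    let b : ℕ → ℤ := fun k => (([6, 1, 1, 1, 1, 1, 0, 0] : List ℤ)).getD k 0
    ¬ GoodClasses b 5 3 ∧ pairFloors b 5 = 11 ∧ casLB b 5 = -11 ∧ multiDepth b 5 = 7 ∧
      rungJGuard b 5 = true ∧ coverGuard b 1 5 0 = true := by
  decide

/-- The smallest residual instance of gen 11's node on zone C: `b = (10; 5,3,3,3,3,1,1)`, `j = 2`, `p = 5` — `N_5 = 9`,
`refund = 1`, `casLB = −9`, `multiDepth = 6`; the Lemma-D guard fires, so the bonus-free class law (CV)
`v ≥ refund − N_5 = −8 = casLB + 1` IS certified (`δ = 0`), but gen 11's flat-gauge bonus `zcGamma = 1` (node value `−7`) is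
NOT: no disjunct fires at `δ = 1` (exact value `v_5 Cas_2(b) = −7`: the node holds, one unit above every tree bound). -/
example :
    let b : ℕ → ℤ := fun k => (([10, 5, 3, 3, 3, 3, 1, 1] : List ℤ)).getD k 0
    pairFloors b 5 = 9 ∧ casLB b 5 = -9 ∧ multiDepth b 5 = 6 ∧ coverGuard b 2 5 0 = true ∧ coverGuard b 2 5 1 = false := by
  decide

end Summit.KontsevichZagierPeriods.Zeta5Search.RVFlatGauge

end
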